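import Summits.ResolutionOfSingularities.ResolutionOfSingularities.Theorems.FrobeniusLadderFRationalResolutionVertexClassFromChart
import Literature.AlgebraicGeometry.Resolution.RegularHomLocalization
import HarnessLib

/-!
# Crux `FrobeniusLadder.FRationalResolution` (stmt-ResolutionOfSingularities-15317), line `redirect`,
# stub `stub_diagonalizableQuotientResolution` — REGULARITY OF `Bl_I` LOCALISES; VERTEX CLASSES READ ON THE GLOBAL CHART RING

For the naive sub-recipe (`…VertexClassFromChart.hloc_of_isRegular_affineBlowup_chart`, p839773: a twisted isolated point is settled as soon as
`Bl_{𝔚 C'_𝔚}(Spec C'_𝔚)` is regular) the toric computation is done on the GLOBAL chart ring (as in the cone programme's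
`veroneseCone_isRegular_affineBlowup` / `segreCone_isRegular_affineBlowup`). The passage is ascent of regularity of blow-ups along the regular
homomorphism `C' → C'_𝔚` (tree `isRegularHom_of_isLocalization` + p838626 `isRegular_affineBlowup_map_of_isRegularHom`):

* ★ `isRegular_affineBlowup_localization` — `Bl_I(Spec B)` regular ⇒ `Bl_{I·M⁻¹B}(Spec M⁻¹B)` regular (`B` Noetherian, any localisation);
* ★★ `hloc_of_isRegular_affineBlowup_chart_global` — p839773 with the hypothesis **`Bl_𝔚(Spec C')` regular** (global).

Honest label: plumbing toward ONE leaf stub (no stub, crux or summit closed). No definitions, no named facts, no sorry.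
[cite: StacksProject, Tag 07PT] [cite: Grothendieck1965, (6.8.3)] [cite: Matsumura1987, Thm. 23.7]
-/

noncomputable section

-- single-problem summit: the doubled namespace component is forced
set_option linter.dupNamespace false

open CategoryTheory AlgebraicGeometry TopologicalSpace IsLocalRing TensorProduct
open Literature.AlgebraicGeometry.Resolution
open Summit.ResolutionOfSingularities.ResolutionOfSingularities.Theorems.FRationalResolution

namespace Summit.ResolutionOfSingularities.ResolutionOfSingularities.Theorems.FRationalResolution.BlowupRegularLocalization

/-- ★ **Regularity of blow-ups localises**: for `B` Noetherian and `S = M⁻¹B`, if `Bl_I(Spec B)` is regular then `Bl_{IS}(Spec S)` is regular.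
[cite: StacksProject, Tag 07PT] [cite: Grothendieck1965, (6.8.3)] -/
theorem isRegular_affineBlowup_localization {B : Type} [CommRing B] [IsNoetherianRing B] (M : Submonoid B) (S : Type) [CommRing S]
    [Algebra B S] [IsLocalization M S] (I : Ideal B) (hreg : Scheme.IsRegular (affineBlowup I)) :
    Scheme.IsRegular (affineBlowup (I.map (algebraMap B S))) := by
  haveI : IsNoetherianRing S := IsLocalization.isNoetherianRing M S inferInstance
  exact BlowupRegularCompletionAscent.isRegular_affineBlowup_map_of_isRegularHom (isRegularHom_of_isLocalization M) I hreg

/-- In particular at a prime: `Bl_I(Spec B)` regular ⇒ `Bl_{I B_𝔮}(Spec B_𝔮)` regular. [cite: StacksProject, Tag 07PT] -/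
theorem isRegular_affineBlowup_atPrime {B : Type} [CommRing B] [IsNoetherianRing B] (𝔮 : Ideal B) [𝔮.IsPrime] (I : Ideal B)
    (hreg : Scheme.IsRegular (affineBlowup I)) :
    Scheme.IsRegular (affineBlowup (I.map (algebraMap B (Localization.AtPrime 𝔮)))) :=
  isRegular_affineBlowup_localization 𝔮.primeCompl (Localization.AtPrime 𝔮) I hreg

/-- ★★ **VERTEX CLASSES READ ON THE GLOBAL CHART RING.** `…VertexClassFromChart.hloc_of_isRegular_affineBlowup_chart` (p839773) with the regularity
hypothesis on the blow-up `Bl_𝔚(Spec C')` of the chart ring itself (of finite type over a field) along the maximal ideal `𝔚`.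
[cite: Matsumura1987, Thm. 8.11; Thm. 8.14; §32 p. 256] [cite: StacksProject, Tag 0CDQ; Tag 09EB; Tag 0C4G; Tag 07PT] -/
theorem hloc_of_isRegular_affineBlowup_chart_global (K : Type) [Field K] (X : Scheme.{0}) [IsIntegral X]
    (f : X ⟶ Spec (.of K)) [LocallyOfFiniteType f]
    {B : Type} [CommRing B] [IsDomain B] [Algebra K B] [Algebra.FiniteType K B]
    (ι : Spec (.of B) ⟶ X) [IsOpenImmersion ι] (hι : ι ≫ f = Spec.map (CommRingCat.ofHom (algebraMap K B)))
    (𝔭 : Ideal B) [h𝔭 : 𝔭.IsMaximal] (h𝔭0 : 𝔭 ≠ ⊥)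
    (hsing : ι ⟨𝔭, h𝔭.isPrime⟩ ∉ Scheme.regularLocus X)
    (hregB : ∀ P : Spec (.of B), P.asIdeal ≠ 𝔭 → P ∈ Scheme.regularLocus (Spec (.of B)))
    (K' : Type) [Field K'] [Algebra K K'] [FiniteDimensional K K'] [IsGalois K K']
    (𝔔' : Ideal (B ⊗[K] K')) [h𝔔' : 𝔔'.IsMaximal] (h𝔔'𝔭 : 𝔔'.comap (algebraMap B (B ⊗[K] K')) = 𝔭)
    (k : Type) [Field k] {C' : Type} [CommRing C'] [Algebra (B ⊗[K] K') C'] [Module.Flat (B ⊗[K] K') C'] [Algebra k C']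
    [Algebra.FiniteType k C'] (𝔚 : Ideal C') [h𝔚 : 𝔚.IsMaximal] (h𝔚B : 𝔚.comap (algebraMap (B ⊗[K] K') C') = 𝔔')
    (hunr : 𝔔'.map (algebraMap (B ⊗[K] K') (Localization.AtPrime 𝔚)) = maximalIdeal (Localization.AtPrime 𝔚))
    (hres : ∀ x : C', ∃ b' : B ⊗[K] K', x - algebraMap (B ⊗[K] K') C' b' ∈ 𝔚)
    (hreg : Scheme.IsRegular (affineBlowup 𝔚)) :
    ∃ (V : X.Opens), ι ⟨𝔭, h𝔭.isPrime⟩ ∈ V ∧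
      (∀ t : X, t ∉ Scheme.regularLocus X → t ∈ V → t = ι ⟨𝔭, h𝔭.isPrime⟩) ∧
      ∃ (Y : Scheme.{0}) (ρ : Y ⟶ V), IsProper ρ ∧ Scheme.IsRegular Y ∧
        IsIso (ρ ∣_ (V.ι ⁻¹ᵁ ⟨Scheme.regularLocus X, isOpen_regularLocus_of_locallyOfFiniteType_field f⟩)) ∧
        Dense ((ρ ⁻¹ᵁ (V.ι ⁻¹ᵁ ⟨Scheme.regularLocus X,
          isOpen_regularLocus_of_locallyOfFiniteType_field f⟩) : Y.Opens) : Set Y) := by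
  haveI : IsNoetherianRing C' := Algebra.FiniteType.isNoetherianRing k C'
  exact VertexClassFromChart.hloc_of_isRegular_affineBlowup_chart K X f ι hι 𝔭 h𝔭0 hsing hregB K' 𝔔' h𝔔'𝔭 k 𝔚 h𝔚B hunr hres
    (isRegular_affineBlowup_atPrime 𝔚 𝔚 hreg)

end Summit.ResolutionOfSingularities.ResolutionOfSingularities.Theorems.FRationalResolution.BlowupRegularLocalization

end
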